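/-
Copyright (c) 2026. All rights reserved.
Released under Apache 2.0 license as described in the file LICENSE.
Authors: abc-iut cell, cone prover abc-iut-w6-d034 (block C, wave W6).
-/
import Literature.AnabelianGeometry.AbsoluteAnabelian.MonoAnalyticArchModelProofs
import Literature.AnabelianGeometry.AbsoluteAnabelian.AbsTopIII.RemarksArchimedeanProofs
import HarnessLib

/-!
# [AbsTopIII] Proposition 5.8 (iv)–(vi): the archimedean algorithm is FUNCTORIAL in `TM⊢` — PROOF companion

S. Mochizuki, *Topics in absolute anabelian geometry III: global reconstruction algorithms*,
J. Math. Sci. Univ. Tokyo 22 (2015) 939–1156 [MochizukiAbsTopIII2015], Prop 5.8 (iv)–(vi), manuscript pp. 140–141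
(DAG nodes **AbsTopIII:Prop5.8(iv)**, **(v)**, **(vi)** of the abc-iut cell), with Rmk 2.7.3 p. 61 («`S¹` … a topological
group whose automorphism group is of order 2»).

Proof-only companion (no `def`, no named fact, no hypothesis structure) to `MonoAnalyticLogShells.lean` (p404450; typer's
scope note: "functoriality shadow" only — the TM⊢-functoriality of Prop 5.8 (iv)–(vi) is NOT a typed field of
`MonoAnalyticArchAlgorithm`, cf. plan/L4/DISCHARGE-L4.md «TM⊢-functoriality not typed ⇒ not discharged») and to the discharge
file `MonoAnalyticArchModelProofs.lean` (p411667: for `G = (C, C⃗) ∈ Ob(TM⊢)` with a chart `e : C ≅ 𝒪_ℂ^▷` the output is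
`C~ := ℝ`, `C~ → C^×`, `t ↦ e⁻¹(e^{it})`, `ℐ_{C~} := [-π, π]`, `R_arc := ℝ`, `F := 2π`, …). The ONLY non-canonical ingredient
of that construction is the chart `e`; print asserts the algorithm is "functorial [i.e., relative to `TM⊢`]". PROVED here,
def-free, as the statement a typer would need:

* `exists_sign_of_mulEquiv_complexIntegralMonoid` — a continuous monoid automorphism `ψ` of `𝒪_ℂ^▷ = {0 < ‖z‖ ≤ 1}` acts on
  the unit circle `C^× = S¹` by `e^{it} ↦ e^{iσt}` for a SIGN `σ ∈ {1, -1}` (its restriction to `S¹` is a continuous group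
  automorphism, hence `z ↦ z^{±1}` by `AbsTopIII.Rmk_2_7_3.CircleAutOrderTwo_holds`);
* `TMMono.Iso.exists_sign` — **functoriality of the covering coordinate**: for a morphism `φ : (C₁, C⃗₁) ⥲ (C₂, C⃗₂)` of `TM⊢`
  and charts `e_i : C_i ≅ 𝒪_ℂ^▷`, there is `σ ∈ {±1}` with `φ(e₁⁻¹(e^{it})) = e₂⁻¹(e^{iσt})` for all `t : ℝ = C~`, i.e. `φ`
  lifts to the isomorphism `t ↦ σ·t` of the universal coverings `C~₁ = ℝ → C~₂ = ℝ` of p411667's construction;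
* the outputs of Prop 5.8 (v)–(vi) are invariant under `t ↦ σ·t`, `σ = ±1`, at the ABSTRACT typed level (any
  `A : MonoAnalyticArch M`): `MonoAnalyticArch.neg_image_coreSeg` (`ℐ_{C~}`), `.neg_image_coreBoundary` (`∂ℐ_{C~}`),
  `.neg_image_logShell` (`ℐ(G)`), `.neg_image_units` (`𝒪^×_{k~(G)}`) — so the transported output of `G₁` IS the output of
  `G₂` on core segment, log-shell and units, and `R_arc = ℝ ∋ F = 2π` is untouched; in the complex model:
  `ComplexLogShell.image_mul_sign_coreSegment`, `.image_mul_sign_logShell`, `.image_mul_sign_units`.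

Classical (covering-space classification of `Aut(S¹)`, already in the tree); nothing anabelian is assumed. Refereed pre-IUT
anabelian geometry; nothing here bears on [IUTchIII] Cor. 3.12; typed ≠ discharged elsewhere.
-/

set_option autoImplicit false

noncomputable section

universe u

open Complex

namespace Literature.AnabelianGeometry.AbsoluteAnabelian

/-! ## A continuous automorphism of `𝒪_ℂ^▷` acts on `S¹` by `z ↦ z^{±1}` -/

/-- a point of the unit circle lies in `𝒪_ℂ^▷ = {0 < ‖z‖ ≤ 1}`. [cite: MochizukiAbsTopIII2015, Def 5.6 (i) p. 134] -/
theorem coe_circle_mem_complexIntegralMonoid (z : Circle) : (z : ℂ) ∈ complexIntegralMonoid := by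
  change 0 < ‖(z : ℂ)‖ ∧ ‖(z : ℂ)‖ ≤ 1
  rw [Circle.norm_coe]
  exact ⟨one_pos, le_rfl⟩

/-- a monoid automorphism of `𝒪_ℂ^▷` carries the unit circle (= the units of `𝒪_ℂ^▷`) into itself.
[cite: MochizukiAbsTopIII2015, Prop 5.8 (iv) p. 140] -/
theorem norm_mulEquiv_eq_one (ψ : complexIntegralMonoid ≃* complexIntegralMonoid)
    {w : complexIntegralMonoid} (hw : ‖(w : ℂ)‖ = 1) : ‖(ψ w : ℂ)‖ = 1 := by
  have hw0 : (w : ℂ) ≠ 0 := norm_ne_zero_iff.1 (by rw [hw]; exact one_ne_zero)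
  have hw' : ((w : ℂ))⁻¹ ∈ complexIntegralMonoid := by
    change 0 < ‖((w : ℂ))⁻¹‖ ∧ ‖((w : ℂ))⁻¹‖ ≤ 1
    rw [norm_inv, hw, inv_one]
    exact ⟨one_pos, le_rfl⟩
  have hmul : w * ⟨_, hw'⟩ = 1 := Subtype.ext (mul_inv_cancel₀ hw0)
  have h := congrArg (fun x : complexIntegralMonoid => (ψ x : ℂ)) hmul
  simp only [map_mul, map_one, Submonoid.coe_mul, Submonoid.coe_one] at h
  exact norm_eq_one_of_mul_eq_one (ψ w).2.2 (ψ _).2.2 h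

/-- **Rmk 2.7.3 applied to `𝒪_ℂ^▷`**: a continuous monoid automorphism `ψ` of `𝒪_ℂ^▷ = {0 < ‖z‖ ≤ 1}` restricts on the
unit circle `C^× = S¹` to `z ↦ z` or `z ↦ z⁻¹`; in the covering coordinate, `ψ(e^{it}) = e^{iσt}` with `σ = ±1`.
[cite: MochizukiAbsTopIII2015, Rmk 2.7.3 p. 61] -/
theorem exists_sign_of_mulEquiv_complexIntegralMonoid (ψ : complexIntegralMonoid ≃* complexIntegralMonoid)
    (hψ : Continuous ψ) (hψ' : Continuous ψ.symm) :
    ∃ σ : ℝ, (σ = 1 ∨ σ = -1) ∧ ∀ t : ℝ,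
      (ψ ⟨Complex.exp (t * I), exp_mul_I_mem_complexIntegralMonoid t⟩ : ℂ) = Complex.exp (↑(σ * t) * I) := by
  -- the restriction of `ψ` (and of `ψ⁻¹`) to the circle
  have memS : ∀ (χ : complexIntegralMonoid ≃* complexIntegralMonoid) (z : Circle),
      (χ ⟨z, coe_circle_mem_complexIntegralMonoid z⟩ : ℂ) ∈ Submonoid.unitSphere ℂ := fun χ z =>
    mem_sphere_zero_iff_norm.2 (norm_mulEquiv_eq_one χ (Circle.norm_coe z))
  let g : (complexIntegralMonoid ≃* complexIntegralMonoid) → Circle → Circle := fun χ z =>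
    ⟨(χ ⟨z, coe_circle_mem_complexIntegralMonoid z⟩ : ℂ), memS χ z⟩
  have g_coe : ∀ χ (z : Circle), ((g χ z : Circle) : ℂ) = (χ ⟨z, coe_circle_mem_complexIntegralMonoid z⟩ : ℂ) :=
    fun _ _ => rfl
  have g_mk : ∀ χ (z : Circle),
      (⟨(g χ z : ℂ), coe_circle_mem_complexIntegralMonoid (g χ z)⟩ : complexIntegralMonoid) =
        χ ⟨z, coe_circle_mem_complexIntegralMonoid z⟩ := fun _ _ => Subtype.ext rfl
  have g_cont : ∀ χ : complexIntegralMonoid ≃* complexIntegralMonoid, Continuous χ → Continuous (g χ) := by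
    intro χ hχ
    apply Continuous.subtype_mk
    exact continuous_subtype_val.comp (hχ.comp (Continuous.subtype_mk continuous_subtype_val _))
  let f : Circle ≃ₜ* Circle :=
    { toFun := g ψ
      invFun := g ψ.symm
      left_inv := fun z => Circle.ext (by rw [g_coe, g_mk, MulEquiv.symm_apply_apply])
      right_inv := fun z => Circle.ext (by rw [g_coe, g_mk, MulEquiv.apply_symm_apply])
      map_mul' := fun z w => Circle.ext (by
        have hzw : (⟨((z * w : Circle) : ℂ), coe_circle_mem_complexIntegralMonoid (z * w)⟩ : complexIntegralMonoid) =
            ⟨(z : ℂ), coe_circle_mem_complexIntegralMonoid z⟩ * ⟨(w : ℂ), coe_circle_mem_complexIntegralMonoid w⟩ :=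
          Subtype.ext rfl
        rw [Circle.coe_mul, g_coe, g_coe, g_coe, hzw, map_mul, Submonoid.coe_mul])
      continuous_toFun := g_cont ψ hψ
      continuous_invFun := g_cont ψ.symm hψ' }
  have f_coe : ∀ t : ℝ, ((f (Circle.exp t) : Circle) : ℂ) =
      (ψ ⟨Complex.exp (t * I), exp_mul_I_mem_complexIntegralMonoid t⟩ : ℂ) := fun t => rfl
  rcases AbsTopIII.Rmk_2_7_3.CircleAutOrderTwo_holds f with h | h
  · refine ⟨1, Or.inl rfl, fun t => ?_⟩
    rw [← f_coe, h, ContinuousMulEquiv.refl_apply, Circle.coe_exp]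
    simp
  · refine ⟨-1, Or.inr rfl, fun t => ?_⟩
    rw [← f_coe, h, AbsTopIII.Rmk_2_7_3.circleInv_apply, ← Circle.exp_neg, Circle.coe_exp]
    simp

/-! ## Prop 5.8 (iv)–(v): functoriality of the covering `C~ → C^×` in `TM⊢` -/

/-- **Prop 5.8 (iv)–(v), FUNCTORIALITY [relative to `TM⊢`] of the covering coordinate.** For a morphism
`φ : G₁ = (C₁, C⃗₁) ⥲ G₂ = (C₂, C⃗₂)` of `TM⊢` and charts `e_i : C_i ≅ 𝒪_ℂ^▷` (the only choice made by the construction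
of p411667, whose covering is `C~ = ℝ → C^×`, `t ↦ e⁻¹(e^{it})`), there is a sign `σ = ±1` with
`φ(e₁⁻¹(e^{it})) = e₂⁻¹(e^{iσt})` for every `t`: `φ` lifts to the isomorphism `t ↦ σ·t` of universal coverings
`C~₁ ⥲ C~₂`. [cite: MochizukiAbsTopIII2015, Prop 5.8 (v) p. 140] -/
theorem TMMono.Iso.exists_sign {M₁ M₂ : TMMono.{u}} (φ : TMMono.Iso M₁ M₂)
    (e₁ : M₁.C ≃* complexIntegralMonoid) (he₁ : Continuous e₁) (he₁' : Continuous e₁.symm)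
    (e₂ : M₂.C ≃* complexIntegralMonoid) (he₂ : Continuous e₂) (he₂' : Continuous e₂.symm) :
    ∃ σ : ℝ, (σ = 1 ∨ σ = -1) ∧ ∀ t : ℝ,
      φ.toMulEquiv (e₁.symm ⟨Complex.exp (t * I), exp_mul_I_mem_complexIntegralMonoid t⟩) =
        e₂.symm ⟨Complex.exp (↑(σ * t) * I), exp_mul_I_mem_complexIntegralMonoid (σ * t)⟩ := by
  let ψ : complexIntegralMonoid ≃* complexIntegralMonoid := (e₁.symm.trans φ.toMulEquiv).trans e₂
  have hψ_apply : ∀ w, ψ w = e₂ (φ.toMulEquiv (e₁.symm w)) := fun _ => rfl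
  have hψ_symm_apply : ∀ w, ψ.symm w = e₁ (φ.toMulEquiv.symm (e₂.symm w)) := fun _ => rfl
  have hψ : Continuous ψ := by
    rw [show (ψ : complexIntegralMonoid → complexIntegralMonoid) = fun w => e₂ (φ.toMulEquiv (e₁.symm w)) from
      funext hψ_apply]
    exact he₂.comp (φ.continuous_toFun.comp he₁')
  have hψ' : Continuous ψ.symm := by
    rw [show (ψ.symm : complexIntegralMonoid → complexIntegralMonoid) =
      fun w => e₁ (φ.toMulEquiv.symm (e₂.symm w)) from funext hψ_symm_apply]
    exact he₁.comp (φ.continuous_invFun.comp he₂')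
  obtain ⟨σ, hσ, h⟩ := exists_sign_of_mulEquiv_complexIntegralMonoid ψ hψ hψ'
  refine ⟨σ, hσ, fun t => ?_⟩
  have hψt : ψ ⟨Complex.exp (t * I), exp_mul_I_mem_complexIntegralMonoid t⟩ =
      ⟨Complex.exp (↑(σ * t) * I), exp_mul_I_mem_complexIntegralMonoid (σ * t)⟩ := Subtype.ext (h t)
  calc φ.toMulEquiv (e₁.symm ⟨Complex.exp (t * I), exp_mul_I_mem_complexIntegralMonoid t⟩)
      = e₂.symm (e₂ (φ.toMulEquiv (e₁.symm ⟨Complex.exp (t * I), exp_mul_I_mem_complexIntegralMonoid t⟩))) :=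
        (e₂.symm_apply_apply _).symm
    _ = e₂.symm (ψ ⟨Complex.exp (t * I), exp_mul_I_mem_complexIntegralMonoid t⟩) := by rw [hψ_apply]
    _ = e₂.symm ⟨Complex.exp (↑(σ * t) * I), exp_mul_I_mem_complexIntegralMonoid (σ * t)⟩ := by rw [hψt]

/-! ## The sign `σ = ±1` acts trivially on every output of Prop 5.8 (v)–(vi) -/

/-- a subset of a real vector space stable under `x ↦ -x` is carried onto itself by `x ↦ σ • x`, `σ = ±1`.
[cite: MochizukiAbsTopIII2015, Prop 5.8 (v) p. 140] -/
theorem image_smul_sign_eq_self {V : Type*} [AddCommGroup V] [Module ℝ V] {S : Set V}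
    (hS : ∀ x ∈ S, -x ∈ S) {σ : ℝ} (hσ : σ = 1 ∨ σ = -1) : (fun x : V => σ • x) '' S = S := by
  rcases hσ with rfl | rfl
  · simp
  · ext x
    simp only [neg_one_smul, Set.mem_image]
    constructor
    · rintro ⟨y, hy, rfl⟩
      exact hS y hy
    · intro hx
      exact ⟨-x, hS x hx, neg_neg x⟩

namespace MonoAnalyticArch

variable {M : TMMono.{u}} (A : MonoAnalyticArch M)

/-- `∂ℐ_{C~}` is invariant under `±1`. [cite: MochizukiAbsTopIII2015, Prop 5.8 (vi) p. 141] -/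
theorem neg_mem_coreBoundary {x : A.cover} (hx : x ∈ A.coreBoundary) : -x ∈ A.coreBoundary := by
  obtain ⟨h1, h2, h3⟩ := hx
  exact ⟨A.neg_mem_coreSeg h1, neg_ne_zero.2 h2, by rw [neg_neg, h3]⟩

/-- the log-shell `ℐ(G) ⊆ k~(G) = C~ × C~` is invariant under `(x, y) ↦ (-x, -y)`.
[cite: MochizukiAbsTopIII2015, Prop 5.8 (v) p. 140] -/
theorem neg_mem_logShell {z : A.shell} (hz : z ∈ A.logShell) : -z ∈ A.logShell := by
  obtain ⟨a, b, x, hx, hab, rfl⟩ := hz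
  exact ⟨a, b, -x, A.neg_mem_coreSeg hx, hab, by simp⟩

/-- `𝒪^×_{k~(G)} ⊆ k~(G)` is invariant under `(x, y) ↦ (-x, -y)`. [cite: MochizukiAbsTopIII2015, Prop 5.8 (vi) p. 141] -/
theorem neg_mem_units {z : A.shell} (hz : z ∈ A.units) : -z ∈ A.units := by
  obtain ⟨a, b, x, hx, hab, rfl⟩ := hz
  exact ⟨a, b, -x, A.neg_mem_coreBoundary hx, hab, by simp⟩

/-- **Prop 5.8 (v) under `TM⊢`-morphisms**: the lift `t ↦ σ·t` (`σ = ±1`, `TMMono.Iso.exists_sign`) of a morphism of `TM⊢`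
to the coverings carries `ℐ_{C~}` onto `ℐ_{C~}` — at the abstract typed level, for every output datum `A`.
[cite: MochizukiAbsTopIII2015, Prop 5.8 (v) p. 140] -/
theorem image_sign_coreSeg {σ : ℝ} (hσ : σ = 1 ∨ σ = -1) : (fun x : A.cover => σ • x) '' A.coreSeg = A.coreSeg :=
  image_smul_sign_eq_self (fun _ hx => A.neg_mem_coreSeg hx) hσ

/-- … carries `∂ℐ_{C~}` onto `∂ℐ_{C~}`. [cite: MochizukiAbsTopIII2015, Prop 5.8 (vi) p. 141] -/
theorem image_sign_coreBoundary {σ : ℝ} (hσ : σ = 1 ∨ σ = -1) :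
    (fun x : A.cover => σ • x) '' A.coreBoundary = A.coreBoundary :=
  image_smul_sign_eq_self (fun _ hx => A.neg_mem_coreBoundary hx) hσ

/-- … carries the log-shell `ℐ(G₁)` onto `ℐ(G₂)` (read: `(x, y) ↦ (σx, σy)` on `k~(G) = C~ × C~` preserves `ℐ(G)`).
[cite: MochizukiAbsTopIII2015, Prop 5.8 (v) p. 140] -/
theorem image_sign_logShell {σ : ℝ} (hσ : σ = 1 ∨ σ = -1) : (fun z : A.shell => σ • z) '' A.logShell = A.logShell :=
  image_smul_sign_eq_self (fun _ hz => A.neg_mem_logShell hz) hσ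

/-- … carries `𝒪^×_{k~(G₁)}` onto `𝒪^×_{k~(G₂)}`. [cite: MochizukiAbsTopIII2015, Prop 5.8 (vi) p. 141] -/
theorem image_sign_units {σ : ℝ} (hσ : σ = 1 ∨ σ = -1) : (fun z : A.shell => σ • z) '' A.units = A.units :=
  image_smul_sign_eq_self (fun _ hz => A.neg_mem_units hz) hσ

end MonoAnalyticArch

namespace ComplexLogShell

/-- in the complex model: `x ↦ σx` (`σ = ±1`) preserves `ℐ_{C~} = [-π, π]`. [cite: MochizukiAbsTopIII2015, Prop 5.8 (v) p. 140] -/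
theorem image_mul_sign_coreSegment {σ : ℝ} (hσ : σ = 1 ∨ σ = -1) : (fun x : ℝ => σ * x) '' coreSegment = coreSegment := by
  have h := image_smul_sign_eq_self (V := ℝ) (S := coreSegment)
    (fun x hx => ⟨by linarith [hx.2], by linarith [hx.1]⟩) hσ
  simpa only [smul_eq_mul] using h

/-- in the complex model `k~ ≅ ℂ`: `z ↦ σz` (`σ = ±1`) preserves the log-shell `ℐ = closedBall 0 π`.
[cite: MochizukiAbsTopIII2015, Prop 5.8 (v) p. 140] -/
theorem image_mul_sign_logShell {σ : ℝ} (hσ : σ = 1 ∨ σ = -1) : (fun z : ℂ => (σ : ℂ) * z) '' logShell = logShell := by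
  have h := image_smul_sign_eq_self (V := ℂ) (S := logShell) (fun z hz => by
    rw [logShell_eq_closedBall, Metric.mem_closedBall, dist_zero_right] at hz ⊢
    rwa [norm_neg]) hσ
  simpa only [Complex.real_smul] using h

/-- in the complex model: `z ↦ σz` (`σ = ±1`) preserves `𝒪^×_{k~} = S¹`. [cite: MochizukiAbsTopIII2015, Prop 5.8 (vi) p. 141] -/
theorem image_mul_sign_units {σ : ℝ} (hσ : σ = 1 ∨ σ = -1) : (fun z : ℂ => (σ : ℂ) * z) '' units = units := by
  have h := image_smul_sign_eq_self (V := ℂ) (S := units) (fun z hz => by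
    rw [units_eq_sphere, mem_sphere_zero_iff_norm] at hz ⊢
    rwa [norm_neg]) hσ
  simpa only [Complex.real_smul] using h

end ComplexLogShell

/-- **Prop 5.8 (vi) under `TM⊢`-morphisms**: the radial volume of [AbsTopIII] Prop 5.7 (ii) on `k~ ≅ ℂ` is invariant under
`z ↦ σz`, `σ = ±1` (indeed under any norm-preserving map), so the transported radial log-volume of `G₁` is that of `G₂`.
[cite: MochizukiAbsTopIII2015, Prop 5.8 (vi) p. 141] -/
theorem ComplexVolume.radialVolume_image_mul_sign {σ : ℝ} (hσ : σ = 1 ∨ σ = -1) (S : Set ℂ) :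
    ComplexVolume.radialVolume ((fun z : ℂ => (σ : ℂ) * z) '' S) = ComplexVolume.radialVolume S := by
  have hσ1 : ‖(σ : ℂ)‖ = 1 := by
    rcases hσ with rfl | rfl <;> simp
  unfold ComplexVolume.radialVolume
  rw [Set.image_image]
  congr 3
  ext z
  simp only [norm_mul, hσ1, one_mul]

/-- … hence so is the radial log-volume `μ^log`. [cite: MochizukiAbsTopIII2015, Prop 5.8 (vi) p. 141] -/
theorem ComplexVolume.radialLogVolume_image_mul_sign {σ : ℝ} (hσ : σ = 1 ∨ σ = -1) (S : Set ℂ) :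
    ComplexVolume.radialLogVolume ((fun z : ℂ => (σ : ℂ) * z) '' S) = ComplexVolume.radialLogVolume S := by
  unfold ComplexVolume.radialLogVolume
  rw [ComplexVolume.radialVolume_image_mul_sign hσ]

end Literature.AnabelianGeometry.AbsoluteAnabelian

end
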